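import Literature.MathematicalPhysics.QuantumFieldTheory.Balaban1983to89.Node00.Record13CarriersB13
import Summits.QuantumFields.YangMills.Theorems.BalabanUVNodesN10AtRecord12B13FamilyRateDischarged

/-!
# BalabanUVNodes ∕ N10 AT def-T's STAGE-13 RECORD (`Record13` v1.1) THROUGH THE [B13] PIN — [Balaban1988RG2Cluster] Lemmas 1–3 knit BY NAME at a run bound to the
# C-binding of the [B13]-pinned Stage-13 view (`Node00/Record13CarriersB13`: `Stage13Params.pinB13`, UP-SIDE); the K1″-facing ∃-face «a ₁₃C record of θ's OWN
# datum with `Dag.B13_main` at every run» from the leaf ∕ the family leaf of record; and its honesty twin (Track A, DAG node N10 [B13]; strategy s2 «by-name knit at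
# the record»; seat `pub-ymgap-dag-n10-d` g5; the ₁₃ successor of `…N10AtRecord12B13` p468258 §1∕§3 and `…N10AtRecord12B13Family` p480148 §2, by `12 ↦ 13`)

HONEST FRAMING.  Count-neutral kernel bookkeeping over LANDED modules: def-T's `Node00/Record13` (p486037 → v1.1 p488788: `Stage13Params`, `toStage5₁₃`, `datumOfRecord₁₃`,
`IsRecordOfRecord₁₃C`), this seat's `Node00/Record13Carriers` ∕ `Node00/Record13CarriersB13` (the ₁₃ carrier stack per dag-lead WORDS-130: `Stage13Params.rebindX`, the
pins, `Stage13Params.pinB13`, `Provisos₁₃.pinB13`, `datumOfRecord₁₃_pinB13 : rfl`, `b13_main_at_toStage5₁₃_pinB13`), def-B13's `CarriersB13` ∕ `Record12CarriersB13(Family)`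
(the group of record, the zero tower, the family currency `ResidB13Fam₁₂ ∕ B13FamLeafOfRecord₁₂ ∕ b13LeafOfRecord_member₁₂` — READ AT `θ.toStage12Params`: the [B13]
group's objects are Stage-3-keyed and the letters of record `c13OfRecord₁₂` read `θ.s2 ∕ θ.γ ∕ θ.ℓ₆`, all Stage-12 fields, so NOTHING of the group is re-typed at ₁₃).
WHAT IS ₁₃ HERE: the record predicate `IsRecordOfRecord₁₃C` (the (2.9)-species β at the canonical-version transport, `rstep` integrable, ranged background proviso)
and the datum `datumOfRecord₁₃`; the [B13] pin commutes with both (UP-SIDE).  §1 N10 at `(w, P)` bound to the [B13]-pinned ₁₃ view from THE LEAF `B13LeafOfRecord θ₃ (lam13 P)`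
(any supplier: `…N10AtRecord11B13` §1 located ∕ termwise, `…N10B13KernelTowerWalks` at the kernel tower, dag-n10-c's rung editions) or from THE FAMILY LEAF OF RECORD
at a box member (`…N10AtRecord12B13Family(Witness ∕ RateDischarged)` §1).  §2 the K1″-facing ∃-faces.  §3 HONESTY (R433 species, as p468258 §3): in the ∃-currency the
N10 conjunct is junk-dischargeable at EVERY Stage-13 package with provisos through def-B13's ZERO TOWER — content = the term tower OF RECORD (def-B13's storeys) or the
∀-lawful ∕ termwise located inputs as THEOREMS about it.  Nothing of Bałaban's is asserted; N10 is NOT discharged; K0″ is NOT asserted; no node count moves; one finite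
four-torus programme at fixed ε per run; nothing continuum ∕ ℝ⁴ ∕ OS ∕ mass-gap ∕ Clay.  0 `sorry`, 0 `def`, standard axioms.  Filed `--supports` the re-keyed K1-class item
of route «BalabanUVNodes» (rev 16's `StabilityBAtRecordR13e`; until plan's KEY line the rev-15 id stmt-QuantumFields-19903).

WHAT THIS FILE PROVES.  §1 `b13_main_at_pinB13₁₃_of_leafOfRecord`, `b13_main_at_pinB13K₁₃_of_leafOfRecord`, `b13_main_at_pinB13₁₃_of_famLeafOfRecord`;
§2 `exists_record₁₃C_pinB13World_b13_main_of_leafOfRecord`, `exists_record₁₃C_pinB13World_b13_main_of_famLeafOfRecord`; §3 `exists_record₁₃C_world_b13_main_of_zeroTower`.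
-/

namespace Summit.QuantumFields.YangMills.BalabanUVNodes.N10AtRecord13B13

open Literature.MathematicalPhysics.QuantumFieldTheory.Balaban1983to89
open Literature.MathematicalPhysics.QuantumFieldTheory.Balaban1983to89.T4Continuum
open Literature.MathematicalPhysics.QuantumFieldTheory.Balaban1983to89.DagBinding
open Literature.MathematicalPhysics.QuantumFieldTheory.Balaban1983to89.Node00
open scoped Matrix.Norms.L2Operator

/-! ## §1. N10 at a run bound to the C-binding of the [B13]-pinned Stage-13 view, from the leaf ∕ the family leaf of record -/

section Pin

variable (F : T4Family) (N : ℕ) [NeZero N]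
variable (θ : Stage13Params F N) (lam13 : B12.RunParams → ResidB13 θ.toStage3Params) (w : WorldP) (P : B12.RunParams)

/-- **N10 AT `(w, P)` BOUND TO THE C-BINDING OF THE [B13]-PINNED STAGE-13 VIEW, FROM THE LEAF AT THE GROUP OF RECORD** (`Record13CarriersB13.b13_main_at_toStage5₁₃_pinB13`;
the in-edges are not needed once the leaf is given). [cite: Balaban1988RG2Cluster, Lemma 1 p.9, Lemma 2 p.11, Lemma 3 p.20 (the node at the objects of record)] -/
theorem b13_main_at_pinB13₁₃_of_leafOfRecord (hup : w.up P = upOfRecord₅C F N ((θ.pinB13 F N lam13).toStage5₁₃ F N) P)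
    (hleaf : B13LeafOfRecord θ.toStage3Params (lam13 P)) : Dag.B13_main (leavesP w P) :=
  b13_main_at_toStage5₁₃_pinB13 θ lam13 w P hup fun _ _ _ _ => hleaf

/-- **The same at the KERNEL-KEYED pin** (`Stage13Params.pinB13K`, def-B13 g4's layers of record): the leaf at `(lamK P).layer` — e.g. this seat's
`…N10B13KernelTowerWalks.b13LeafOfRecord_layer_of_located_walks` — gives N10 at the run. [cite: Balaban1988RG2Cluster, Lemmas 1–3 pp.9, 11, 20 and (2.14) p.15] -/
theorem b13_main_at_pinB13K₁₃_of_leafOfRecord (lamK : B12.RunParams → ResidB13K θ.toStage3Params)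
    (hup : w.up P = upOfRecord₅C F N ((θ.pinB13K F N lamK).toStage5₁₃ F N) P) (hleaf : B13LeafOfRecord θ.toStage3Params (lamK P).layer) :
    Dag.B13_main (leavesP w P) :=
  b13_main_at_toStage5₁₃_pinB13 θ (fun P => (lamK P).layer) w P hup fun _ _ _ _ => hleaf

variable (c : B13.Consts) (lamF : ResidB13Fam₁₂ F N θ.toStage12Params)

/-- **N10 AT A RUN BOUND TO THE [B13] PIN AT A BOX MEMBER OF A STAGE-12∕13 FAMILY, FROM THE FAMILY LEAF OF RECORD** (def-B13 g3's member bridge `b13LeafOfRecord_member₁₂`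
READ AT `θ.toStage12Params` — the family currency and the letters of record `c13OfRecord₁₂` are Stage-12-keyed and unchanged at ₁₃): given the family leaf at the run,
a member `(k, v)` in the window-of-record box with the letters of record, and any per-run layer `lam13` that AT `P` is that member, the world bound to the C-binding of
`(θ.pinB13 lam13).toStage5₁₃` has `Dag.B13_main` at `P`. [cite: Balaban1988RG2Cluster, Lemmas 1–3 pp.9, 11, 20; Balaban1987RG1, Thm 3 p.264 (one family, every step)] -/
theorem b13_main_at_pinB13₁₃_of_famLeafOfRecord (hleaf : B13FamLeafOfRecord₁₂ F N θ.toStage12Params c lamF P) {k : ℕ} {v : Fin (k + 1) → ℝ}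
    (hv : v ∈ FlowStep.Box θ.γ k) (hc : (lamF P k v).c = c13OfRecord₁₂ F N θ.toStage12Params c) (hsel : lam13 P = lamF P k v)
    (hup : w.up P = upOfRecord₅C F N ((θ.pinB13 F N lam13).toStage5₁₃ F N) P) : Dag.B13_main (leavesP w P) := by
  refine b13_main_at_pinB13₁₃_of_leafOfRecord F N θ lam13 w P hup ?_
  rw [hsel]
  exact b13LeafOfRecord_member₁₂ hleaf hv hc

end Pin

/-! ## §2. The K1″-facing ∃-faces: a ₁₃C record of θ's OWN datum with `Dag.B13_main` at every run -/

section K1Facing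

variable (F : T4Family) (N : ℕ) [NeZero N]

/-- **FOR ANY ADMISSIBLE STAGE-13 PACKAGE `θ` WITH PROVISOS AND ANY PER-RUN [B13] LAYER CARRYING THE LEAF AT EVERY RUN, THE WORLD BOUND AT THE C-BINDING OF THE
[B13]-PINNED STAGE-13 VIEW IS A ₁₃C RECORD OF θ's OWN DATUM WITH `Dag.B13_main` AT EVERY RUN** (any window `γw ∈ ]0, θ.γ]`, block size `θ.L`).  The pin is UP-SIDE
(`Record13CarriersB13.datumOfRecord₁₃_pinB13`: the pinned package has θ's provisos, admissibility and datum; `θ.Zt`, `θ.ppSel`, `ε₂₉` untouched — so the rev-16 guard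
conjuncts of the tuple are the tuple's).  N10's conjunct of the re-keyed K1-class item «given the tuple, SOME world of ITS datum at which every run satisfies the nodes»,
modulo the leaf (§1's suppliers) and the other nodes at the SAME world (their seats' faces at pinned ₁₃ views, `Node00/Record13Carriers`).  Count-neutral.
[cite: Balaban1988RG2Cluster, Lemmas 1–3 pp.9, 11, 20; Balaban1989LargeFieldII, Thm 1 + (0.1) pp.355–356 (the record)] -/
theorem exists_record₁₃C_pinB13World_b13_main_of_leafOfRecord (θ : Stage13Params F N) (h : θ.Provisos₁₃ F N) (hθ : θ.Admissible F N)
    (lam13 : B12.RunParams → ResidB13 θ.toStage3Params) {γw : ℝ} (hγw : 0 < γw ∧ γw ≤ θ.γ)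
    (hleaf : ∀ P, B13LeafOfRecord θ.toStage3Params (lam13 P)) :
    ∃ w : WorldP, IsRecordOfRecord₁₃C F N (datumOfRecord₁₃ F N θ h) w ∧ w.γ = γw ∧ w.L = (θ.L : ℝ) ∧
      (∀ P, w.up P = upOfRecord₅C F N ((θ.pinB13 F N lam13).toStage5₁₃ F N) P) ∧ ∀ P : B12.RunParams, Dag.B13_main (leavesP w P) := by
  obtain ⟨w₀⟩ := nonempty_worldP
  let w : WorldP :=
    { w₀ with
      C := (datumOfRecord₁₃ F N θ h).C, γ := γw, L := (θ.L : ℝ), one_lt_L := by exact_mod_cast θ.hL.2,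
      up := fun P => upOfRecord₅C F N ((θ.pinB13 F N lam13).toStage5₁₃ F N) P }
  have hR : IsRecordOfRecord₁₃C F N (datumOfRecord₁₃ F N (θ.pinB13 F N lam13) (h.pinB13 lam13)) w :=
    isRecordOfRecord₁₃C_of_eq F N (θ.pinB13 F N lam13) (h.pinB13 lam13) ((Stage13Params.pinB13_admissible_iff F N θ lam13).2 hθ) w
      (by rw [datumOfRecord₁₃_pinB13 F N θ h lam13]) hγw rfl fun _ => rfl
  rw [datumOfRecord₁₃_pinB13 F N θ h lam13] at hR
  exact ⟨w, hR, rfl, rfl, fun _ => rfl, fun P => b13_main_at_pinB13₁₃_of_leafOfRecord F N θ lam13 w P rfl (hleaf P)⟩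

/-- **THE SAME IN THE FAMILY CURRENCY**: for any Stage-12∕13 [B13] family carrying the family leaf of record at EVERY run and any per-run SELECTION of a box member with
the letters of record (`κ P, ν P` — displayed; e.g. a step of the run at its own coupling prefix), the world bound at the C-binding of the view [B13]-PINNED AT THE
SELECTED MEMBERS is a ₁₃C record of θ's own datum with `Dag.B13_main` at every run. [cite: Balaban1988RG2Cluster, Lemmas 1–3 pp.9, 11, 20; Balaban1987RG1, Thm 3 p.264; Balaban1989LargeFieldII, Thm 1 + (0.1) pp.355–356] -/
theorem exists_record₁₃C_pinB13World_b13_main_of_famLeafOfRecord (θ : Stage13Params F N) (h : θ.Provisos₁₃ F N) (hθ : θ.Admissible F N) {γw : ℝ}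
    (hγw : 0 < γw ∧ γw ≤ θ.γ) (c : B13.Consts) (lamF : ResidB13Fam₁₂ F N θ.toStage12Params)
    (hleaf : ∀ P, B13FamLeafOfRecord₁₂ F N θ.toStage12Params c lamF P) (κ : B12.RunParams → ℕ) (ν : (P : B12.RunParams) → Fin (κ P + 1) → ℝ)
    (hν : ∀ P, ν P ∈ FlowStep.Box θ.γ (κ P)) (hc : ∀ P, (lamF P (κ P) (ν P)).c = c13OfRecord₁₂ F N θ.toStage12Params c) :
    ∃ w : WorldP, IsRecordOfRecord₁₃C F N (datumOfRecord₁₃ F N θ h) w ∧ w.γ = γw ∧ w.L = (θ.L : ℝ) ∧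
      (∀ P, w.up P = upOfRecord₅C F N ((θ.pinB13 F N fun P => lamF P (κ P) (ν P)).toStage5₁₃ F N) P) ∧
        ∀ P : B12.RunParams, Dag.B13_main (leavesP w P) :=
  exists_record₁₃C_pinB13World_b13_main_of_leafOfRecord F N θ h hθ (fun P => lamF P (κ P) (ν P)) hγw
    fun P => b13LeafOfRecord_member₁₂ (hleaf P) (hν P) (hc P)

end K1Facing

/-! ## §3. HONESTY (R433 species): the ∃-currency is junk-dischargeable through def-B13's zero tower at EVERY Stage-13 package -/

section Honesty

variable (F : T4Family) (N : ℕ) [NeZero N]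

/-- **N10's CONJUNCT OF «NODES AT SOME STAGE-13 RECORD» IS JUNK-DISCHARGEABLE IN THE ∃-CURRENCY, AT EVERY STAGE-13 PACKAGE WITH PROVISOS.**  §2 with `lam13 :=`
def-B13's ZERO TERM TOWER WITH FULL SPACES (`Node00.exists_residB13_b13LeafOfRecord_univ`).  WHAT THIS SAYS (for the rev-16 planner and the referees, not against
print): as typed, an ∃-world conjunct «… `B13_main` …» carries NO content of [Balaban1988RG2Cluster]; content enters only when `lam13` is PINNED to a term tower OF
RECORD (def-B13's storeys: `CarriersB13KernelTower` and sequels) with the leaf supplied from located inputs that are THEOREMS about that tower.  Count-neutral.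
[cite: Balaban1988RG2Cluster, (1.33) p.9, (1.41)–(1.42) p.11, (2.9)–(2.14) pp.14–15, Lemmas 1–3 pp.9, 11, 20] -/
theorem exists_record₁₃C_world_b13_main_of_zeroTower (θ : Stage13Params F N) (h : θ.Provisos₁₃ F N) (hθ : θ.Admissible F N) {γw : ℝ}
    (hγw : 0 < γw ∧ γw ≤ θ.γ) :
    ∃ w : WorldP, IsRecordOfRecord₁₃C F N (datumOfRecord₁₃ F N θ h) w ∧ w.γ = γw ∧ w.L = (θ.L : ℝ) ∧ ∀ P : B12.RunParams, Dag.B13_main (leavesP w P) := by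
  obtain ⟨lam, -, -, -, hleaf⟩ := exists_residB13_b13LeafOfRecord_univ θ.toStage3Params
  obtain ⟨w, hR, hγ, hL, -, hN⟩ := exists_record₁₃C_pinB13World_b13_main_of_leafOfRecord F N θ h hθ (fun _ => lam) hγw fun _ => hleaf
  exact ⟨w, hR, hγ, hL, hN⟩

end Honesty

end Summit.QuantumFields.YangMills.BalabanUVNodes.N10AtRecord13B13
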